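import Literature.Analysis.FluidPDE.NSRegFourierGlobal
import Literature.Analysis.FluidPDE.NSRegFourierFamily
import Literature.Analysis.FluidPDE.NSFourierTimeRegularity
import HarnessLib

/-!
# Time-derivative bootstrap for regularised mild solutions of every weight

Eighth file of the Fourier-side construction of the global regular solution of the
Leray-regularised Navier–Stokes system (discharge of
`Literature.Analysis.FluidPDE.leray_regularised_wellposed`). A coefficient field `V` which is a
regularised mild solution on `[0, T]` of **every** weight (`IsRegMildAll`, e.g. the global solution
of `NSRegFourierGlobal` for a datum in every weighted `L²`) is square-dominated of every order
(`IsRegMildAll.dom_weight`: `(1+‖ξ‖)^K ‖V(t,ξ)‖ ≤ (1+‖ξ‖)^K ‖V(0,ξ)‖ + C (1+‖ξ‖)^{-(card ι+1)}`,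
from the Duhamel formula based at `0` and the pointwise Duhamel bound of `NSRegFourierDuhamel`),
and is therefore the zeroth member of square-dominated families of every order
(`IsRegMildAll.exists_domFamily`), by induction on the order through the differential equation
`∂ₜ V = -c‖ξ‖² V − N(m•V, V)` and the closure properties of `NSRegFourierFamily` — the analogue of
`NSFourierTimeRegularity.PicardHyp.exists_family` for `L²` data (Leray 1934, §19, pp. 220–221,
and §26; Ożański–Pooley 2018, Cor. 6.16).

## References

* J. Leray, Acta Math. 63 (1934), §19, §26. [Leray1934]
* W. S. Ożański, B. C. Pooley, LMS Lecture Note Ser. 452 (2018), Cor. 6.16, Cor. 6.25. [OzanskiPooley2018]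
-/

noncomputable section

open MeasureTheory Real Set Filter Topology Function Complex
open scoped ENNReal ComplexConjugate

namespace Literature.Analysis.FluidPDE.FourierNS

variable {ι : Type*} [Fintype ι] [DecidableEq ι]

/-- **Regularised mild solution of every weight on `[0, T]`.** [folklore] -/
def IsRegMildAll (c : ℝ) (m : (EuclideanSpace ℝ ι) → ℝ) (T : ℝ) (V : ℝ → (EuclideanSpace ℝ ι) → ι → ℂ) : Prop :=
  ∀ K : ℕ, IsRegMild c m K 0 T V

namespace IsRegMildAll

variable {c T : ℝ} {m : (EuclideanSpace ℝ ι) → ℝ} {V : ℝ → (EuclideanSpace ℝ ι) → ι → ℂ}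

/-- **Square domination of every order.** For `t ∈ [0, T]`,
`(1+‖ξ‖)^K ‖V(t,ξ)‖ ≤ G_K(ξ)` with `G_K ∈ L²`: the Duhamel formula from `0` gives
`‖V(t,ξ)‖ ≤ ‖V(0,ξ)‖ + ‖D(t,ξ)‖`, `wfun K V(0) ∈ L²`, and the Duhamel term decays pointwise to
every order (`SliceBound.weight_mul_enorm_duhamelR_le` at weight `K + card ι + 1`). [folklore] -/
theorem dom_weight (h : IsRegMildAll c m T V) (K : ℕ) :
    ∃ G : (EuclideanSpace ℝ ι) → ℝ, MemLp G 2 volume ∧ ∀ t ∈ Icc 0 T, ∀ ξ, (1 + ‖ξ‖) ^ K * ‖V t ξ‖ ≤ G ξ := by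
  set K₀ := Fintype.card ι + 1 with hK₀def
  set J := K + K₀ with hJdef
  have hJ := h J
  have hm := hJ.hm.measurable
  have hc := hJ.hc
  have hT : 0 ≤ T := hJ.le
  obtain ⟨M, hM⟩ := hJ.hm.decay J
  have hS := hJ.sliceBound
  -- the Duhamel term and its pointwise bound of order `J`
  set CD : ℝ≥0∞ := ENNReal.ofReal (4 * π) * ENNReal.ofReal (1 / (2 * c)) ^ (1 / 2 : ℝ) * ENNReal.ofReal T ^ (1 / 2 : ℝ) *
    ((Fintype.card ι : ℝ≥0∞) ^ 2 * (ENNReal.ofReal M * hJ.A * hJ.B)) with hCdef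
  have hCtop : CD ≠ ∞ := by
    refine ENNReal.mul_ne_top (ENNReal.mul_ne_top (ENNReal.mul_ne_top ENNReal.ofReal_ne_top
      (ENNReal.rpow_ne_top_of_nonneg (by norm_num) ENNReal.ofReal_ne_top))
      (ENNReal.rpow_ne_top_of_nonneg (by norm_num) ENNReal.ofReal_ne_top)) ?_
    exact ENNReal.mul_ne_top (ENNReal.pow_ne_top (ENNReal.natCast_ne_top _))
      (ENNReal.mul_ne_top (ENNReal.mul_ne_top ENNReal.ofReal_ne_top hJ.A_ne_top) hJ.B_ne_top)
  have hD : ∀ t ξ, (1 + ‖ξ‖) ^ J * ‖duhamelR c m T V V t ξ‖ ≤ CD.toReal := by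
    intro t ξ
    have h1 := hS.weight_mul_enorm_duhamelR_le hm hc hT hM t ξ
    rw [← hCdef] at h1
    have h2 : ENNReal.ofReal ((1 + ‖ξ‖) ^ J * ‖duhamelR c m T V V t ξ‖) ≤ CD := by
      rwa [ENNReal.ofReal_mul (by positivity), ofReal_norm]
    exact (ENNReal.ofReal_le_iff_le_toReal hCtop).1 h2
  -- the dominator
  refine ⟨fun ξ => (1 + ‖ξ‖) ^ K * ‖V 0 ξ‖ + CD.toReal * ((1 + ‖ξ‖) ^ K₀)⁻¹, ?_, fun t ht ξ => ?_⟩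
  · refine MemLp.add ?_ ((memLp_inv_one_add_norm_pow_two (ι := ι)).const_mul _)
    have h0 : MemLp (wfun K (V 0)) 2 volume :=
      ⟨aestronglyMeasurable_wfun K (hJ.measurable_slice' 0).aestronglyMeasurable,
        (eLpNorm_wfun_mono (by omega : K ≤ J) (V 0) 2).trans_lt (hJ.eLpNorm_wfun_lt_top 0)⟩
    have := h0.norm
    refine this.congr_norm ?_ (Eventually.of_forall fun ξ => ?_)
    · exact ((by fun_prop : Continuous fun ξ : EuclideanSpace ℝ ι => (1 + ‖ξ‖) ^ K).aestronglyMeasurable.mul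
        (hJ.measurable_slice' 0).norm.aestronglyMeasurable)
    · rw [norm_norm, norm_wfun, Real.norm_of_nonneg (by positivity)]
  · -- `V t = heat • V 0 − D(t)`
    have hdu := hJ.duhamel le_rfl ht.1 ht.2 ξ
    rw [sub_zero] at hdu
    have hDt : (∫ r in (0 : ℝ)..t, heat c ξ (t - r) • nonlin (vmul m (V r)) (V r) ξ) = duhamelR c m T V V t ξ := by
      rw [duhamelR, clamp_of_mem ht]
    rw [hDt] at hdu
    have hnorm : ‖V t ξ‖ ≤ ‖V 0 ξ‖ + ‖duhamelR c m T V V t ξ‖ := by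
      have e1 : ‖heat c ξ t • V 0 ξ‖ ≤ ‖V 0 ξ‖ := by
        rw [norm_smul, Real.norm_of_nonneg (heat_nonneg c ξ t)]
        exact mul_le_of_le_one_left (norm_nonneg _) (heat_le_one hc.le ht.1 ξ)
      calc ‖V t ξ‖ = ‖heat c ξ t • V 0 ξ - duhamelR c m T V V t ξ‖ := by rw [← hdu]
        _ ≤ ‖heat c ξ t • V 0 ξ‖ + ‖duhamelR c m T V V t ξ‖ := norm_sub_le _ _
        _ ≤ ‖V 0 ξ‖ + ‖duhamelR c m T V V t ξ‖ := add_le_add e1 le_rfl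
    have hpos : 0 < (1 + ‖ξ‖) ^ K₀ := by positivity
    calc (1 + ‖ξ‖) ^ K * ‖V t ξ‖ ≤ (1 + ‖ξ‖) ^ K * (‖V 0 ξ‖ + ‖duhamelR c m T V V t ξ‖) := by gcongr
      _ = (1 + ‖ξ‖) ^ K * ‖V 0 ξ‖ + (1 + ‖ξ‖) ^ K * ‖duhamelR c m T V V t ξ‖ := by ring
      _ ≤ (1 + ‖ξ‖) ^ K * ‖V 0 ξ‖ + CD.toReal * ((1 + ‖ξ‖) ^ K₀)⁻¹ := by
          refine add_le_add le_rfl ?_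
          rw [le_mul_inv_iff₀ hpos]
          calc (1 + ‖ξ‖) ^ K * ‖duhamelR c m T V V t ξ‖ * (1 + ‖ξ‖) ^ K₀
              = (1 + ‖ξ‖) ^ J * ‖duhamelR c m T V V t ξ‖ := by rw [hJdef, pow_add]; ring
            _ ≤ CD.toReal := hD t ξ

/-- The component fields `t ↦ (ξ ↦ V(t,ξ)ₗ)` form a square-dominated family of order `0`. [folklore] -/
theorem isDomFamily_zero (h : IsRegMildAll c m T V) (l : ι) : IsDomFamily T 0 (fun _ t ξ => V t ξ l) where
  meas k _ t _ := (measurable_pi_iff.1 ((h 0).measurable_slice' t) l).aestronglyMeasurable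
  dom k _ K := by
    obtain ⟨G, hG, hle⟩ := h.dom_weight K
    exact ⟨G, hG, fun t ht ξ => le_trans (by gcongr; exact norm_le_pi_norm _ l) (hle t ht ξ)⟩
  cont k _ ξ := ((continuous_apply l).comp ((h 0).cont ξ)).continuousOn
  deriv k hk := absurd hk (Nat.not_lt_zero k)

omit [DecidableEq ι] in
/-- The multiplier family `m • W` of a square-dominated vector family (componentwise). [folklore] -/
theorem isDomFamily_vmul {n : ℕ} {W : ℕ → ℝ → (EuclideanSpace ℝ ι) → ι → ℂ} (hm : IsMollifierSymbol m)
    (hW : ∀ j, IsDomFamily T n (fun k t ξ => W k t ξ j)) (j : ι) :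
    IsDomFamily T n (fun k t ξ => vmul m (W k t) ξ j) := by
  have h1 := (hW j).symbol (m := fun ξ => (m ξ : ℂ)) hm.measurable.complex_ofReal.aestronglyMeasurable (d := 0) (M := 1)
    zero_le_one fun ξ => by simpa [Complex.norm_real] using hm.abs_le_one ξ
  exact h1

/-- **Square-dominated families of all orders** for a regularised mild solution of every weight:
`W₀ = V`, `W_{k+1} = -c‖ξ‖² W_k − N(m•W, W)_k` (induction on the order; `∂ₜ V = -c‖ξ‖² V − N(m•V, V)`
by `IsRegMild.hasDerivWithinAt`; Leray 1934, pp. 220–221, §26). [folklore] -/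
theorem exists_domFamily (h : IsRegMildAll c m T V) (hT : 0 < T) (n : ℕ) :
    ∃ W : ℕ → ℝ → (EuclideanSpace ℝ ι) → ι → ℂ, W 0 = V ∧ ∀ l, IsDomFamily T n (fun k t ξ => W k t ξ l) := by
  have hc := (h 0).hc
  have hm := (h 0).hm
  have base := h.isDomFamily_zero
  induction n with
  | zero => exact ⟨fun _ => V, rfl, base⟩
  | succ n ih =>
    obtain ⟨W, hW0, hW⟩ := ih
    set D : ℕ → ℝ → (EuclideanSpace ℝ ι) → ι → ℂ := fun k t ξ l =>
      -((c * ‖ξ‖ ^ 2 : ℝ) : ℂ) * W k t ξ l - nonlinFamily (fun k t => vmul m (W k t)) W k t ξ l with hD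
    have hD_fam : ∀ l, IsDomFamily T n (fun k t ξ => D k t ξ l) := fun l => by
      have h1 : IsDomFamily T n (fun k t ξ => -((c * ‖ξ‖ ^ 2 : ℝ) : ℂ) * W k t ξ l) :=
        (hW l).symbol (m := fun ξ => -((c * ‖ξ‖ ^ 2 : ℝ) : ℂ))
          (by fun_prop : Continuous fun ξ : EuclideanSpace ℝ ι => -((c * ‖ξ‖ ^ 2 : ℝ) : ℂ)).aestronglyMeasurable
          (d := 2) (M := c) hc.le (norm_heatSymbol_le hc.le)
      have h2 : IsDomFamily T n (fun k t ξ => nonlinFamily (fun k t => vmul m (W k t)) W k t ξ l) :=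
        (IsDomFamily.nonlinFamily hT (fun j => isDomFamily_vmul hm hW j) hW l).isDomFamily
      exact h1.sub h2
    refine ⟨consFamily V D, rfl, fun l => ?_⟩
    refine ⟨fun k hk t ht => ?_, fun k hk K => ?_, fun k hk ξ => ?_, fun k hk ξ t ht => ?_⟩
    · cases k with
      | zero => exact (base l).meas 0 le_rfl t ht
      | succ k => exact (hD_fam l).meas k (by omega) t ht
    · cases k with
      | zero => exact (base l).dom 0 le_rfl K
      | succ k => exact (hD_fam l).dom k (by omega) K
    · cases k with
      | zero => exact (base l).cont 0 le_rfl ξ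
      | succ k => exact (hD_fam l).cont k (by omega) ξ
    · cases k with
      | zero =>
        have hd := (h 0).hasDerivWithinAt_apply ξ ht l
        simp only [consFamily_zero, consFamily_succ, zero_add]
        convert hd using 1
        simp only [hD, hW0, nonlinFamily_zero]
      | succ k =>
        simp only [consFamily_succ]
        exact (hD_fam l).deriv k (by omega) ξ t ht

/-- **Pressure families of all orders**: `q_k = presFamily (m•W) W k` is a (pointwise-decaying)
Fourier family of order `n` with `q₀(t) = presSymbol (m•V(t)) (V(t))`. [folklore] -/
theorem exists_presFamily (h : IsRegMildAll c m T V) (hT : 0 < T) (n : ℕ) :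
    ∃ Q : ℕ → ℝ → (EuclideanSpace ℝ ι) → ℂ, (∀ t ξ, Q 0 t ξ = presSymbol (vmul m (V t)) (V t) ξ) ∧ IsFourierFamily T n Q := by
  obtain ⟨W, hW0, hW⟩ := h.exists_domFamily hT n
  refine ⟨presFamily (fun k t => vmul m (W k t)) W, fun t ξ => ?_,
    IsDomFamily.presFamily hT (fun j => isDomFamily_vmul (h 0).hm hW j) hW⟩
  rw [presFamily_zero, hW0]

/-- **Nonlinearity families of all orders**: `N(m•V, V)ₗ` is the zeroth member of a
(pointwise-decaying) Fourier family of every order. [folklore] -/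
theorem exists_nonlinFamily (h : IsRegMildAll c m T V) (hT : 0 < T) (n : ℕ) (l : ι) :
    ∃ N : ℕ → ℝ → (EuclideanSpace ℝ ι) → ℂ, (∀ t ξ, N 0 t ξ = nonlin (vmul m (V t)) (V t) ξ l) ∧ IsFourierFamily T n N := by
  obtain ⟨W, hW0, hW⟩ := h.exists_domFamily hT n
  refine ⟨fun k t ξ => nonlinFamily (fun k t => vmul m (W k t)) W k t ξ l, fun t ξ => ?_,
    IsDomFamily.nonlinFamily hT (fun j => isDomFamily_vmul (h 0).hm hW j) hW l⟩
  simp only [nonlinFamily_zero, hW0]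

end IsRegMildAll

/-- The global solution of `NSRegFourierGlobal` is a regularised mild solution of every weight on
every `[0, T]`, provided the datum lies in every weighted `L²`. [folklore] -/
theorem GlobalHyp.isRegMildAll_gSol {c : ℝ} {m : (EuclideanSpace ℝ ι) → ℝ} {K : ℕ} {a : (EuclideanSpace ℝ ι) → ι → ℂ}
    (h : GlobalHyp c m K a) (hall : ∀ K' : ℕ, eLpNorm (wfun K' a) 2 volume < ⊤) {T : ℝ} (hT : 0 < T) :
    IsRegMildAll c m T (fun t => gSol c m K a (min t T)) := by
  intro K'
  have hK : Fintype.card ι < 2 * K := h.hK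
  exact (h.isRegMild_gSol_weight (K' := max K' K) (by omega) (hall _) hT).of_le (le_max_left _ _)

end Literature.Analysis.FluidPDE.FourierNS

end
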